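import Literature.Combinatorics.Sahi2008.Symmetry
import HarnessLib

/-!
# `NoHeavyLowerTail` (stmt-CriticalPhenomena-4575) — the JOIN-ABSORPTION FACTORISATION of Sahi's functionals `E_n`
# (every order, every weight): `E_{k+1+m}(h_0,…,h_{m−1}, g_0,…,g_k) = Φ_{k+1}(h) · E_{k+1}(g)` when every `h_i` is `1` on the supports of the `g_j`

Support file, seat `prim-l12-p5` (gen 12), `--supports stmt-CriticalPhenomena-4575`.  Standard axioms, no `sorry`, no computation.

THE IDENTITY.  Let `μ` be ANY weight on a finite type, `g_0,…,g_k` ("core", `k+1 ≥ 1` functions) and `h_0,…,h_{m−1}` ("absorbers")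
real functions with `g_j · h_i = g_j` for all `i, j` (e.g. `h_i ∈ [0,1]`-valued and `h_i = 1` wherever some `g_j ≠ 0`; for events:
`H_i ⊇ G_0 ∪ ⋯ ∪ G_k`).  Then
  `E_{k+1+m}(h, g) = absorbFactor_{k+1}(h) · E_{k+1}(g)`,   `absorbFactor_K(h_0,…,h_{m−1}) = Σ_{σ ∈ S_m} Π_{c cycle of σ} (K − E(Π_{i∈c} h_i))`
(`sahiE_joinFam_eq`; the factor is DEFINED here by the insertion recursion
`Φ_K(h_0,…,h_m) = (K − E h_0)·Φ_K(h_1,…,h_m) + Σ_{i≥1} Φ_K(h_1,…,h_i h_0,…,h_m)`, `Φ_K() = 1`, which is the cycle sum read off by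
inserting the letter `0` either as a fixed point or after the letter `i` of a permutation of `{1,…,m}`).
PROOF: induction on `m` through the Lieb–Sahi recursion (the tree's DEFINITION `sahiE_succ_succ`, distinguished slot `0 = h_0`): the
`k+1` core slots give `E(…, g_j h_0, …) = E(…, g_j, …)` (absorption), the absorber slots give a family of the same shape with `h_i ↦ h_i h_0`
(products of absorbers absorb), and the last term is `−E(tail)·E(h_0)`.
For `m = 1` this is the tree's `Literature.…Sahi2008.sahiE_cons_of_absorbing` ([LiebSahi2021, Prop. 3.3 ⇒ Lemma 3.2]; for `h = 1` Sahi's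
branching rule `E_n(f,1) = (n−2)E_{n−1}(f)` [Sahi2008, Thm. 6]); the point of the present file is that SEVERAL absorbers need NOT absorb
EACH OTHER (no chain condition among the `h_i`), so the class "core + functions equal to `1` on the core's support" is closed under
adding arbitrary further such functions.

CONSEQUENCES (all orders, any probability weight, NO monotonicity / FKG hypothesis on the absorbers):
* `absorbFactor_nonneg`, `absorbFactor_ge`: for `0 ≤ h_i ≤ 1` and `K ≥ 1`, `Φ_K(h) ≥ (K−1)^m ≥ 0`.
* `sahiE_joinFam_nonneg` — HEREDITY: `E_{k+1}(g) ≥ 0` ⇒ `E_{k+1+m}(h, g) ≥ 0`.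
* `sahiE_nonneg_of_bottom` — BOTTOM-ELEMENT THEOREM (`k = 0`): a family `(f_0,…,f_m)` of `[0,1]`-valued functions in which every `f_i`
  (`i ≥ 1`) equals `1` wherever `f_0 ≠ 0`, `f_0 ≥ 0`, has `E_{m+1} ≥ 0`; e.g. ANY family of events with a least member under `⊆`
  (generalises the nested-chain theorem `Literature.…Sahi2008.sahiE_indicator_chain_nonneg`, where ALL members are comparable).
* `sahiE_eq_absorbFactor_mul_cov`, `sahiE_nonneg_iff_cov_nonneg` (`k = 1`): with two core functions,
  `E_{m+2}(h, g_0, g_1) = Φ_2(h)·(E(g_0g_1) − E(g_0)E(g_1))` with `Φ_2 ≥ 1`, so `E_{m+2}` HAS THE SIGN OF THE COVARIANCE of the core —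
  in particular it vanishes when `g_0, g_1` are uncorrelated (this explains the identically-zero Bernstein classes of the universal hitting
  polynomials, e.g. `E_4(X∨Y∨Z, X, Y, Z) = E_4(X, Y, X∨Y, X∨Y) = 0` for independent `X, Y, Z`), and is `≥ 0` whenever Harris/FKG gives
  `Cov(g_0,g_1) ≥ 0`.
* `sahiE_nonneg_of_absorbing_perm` — the same statements for an arbitrary placement of the slots (symmetry of `E_n`,
  `Literature.…Sahi2008.sahiE_comp_perm`).
Relation to the tree: `…SahiHereditaryMeetAbsorption` (gen 4) is the DUAL direction (a slot containing the MEET of the others, hereditary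
positivity assumed); `…SahiHittingCoreTrace` (gen 8) eliminates PRIVATE coins; the present JOIN absorption (slots equal to `1` on the
union of the core supports) is exact and hypothesis-free. [this work; LiebSahi2021, Prop. 3.3, Lemma 3.2; Sahi2008, Thm. 6]
-/

namespace Summit.CriticalPhenomena.PercolationContinuityZ3.Theorems

namespace SahiJoinAbsorption

open Finset Literature.Combinatorics.Sahi2008

variable {α : Type*}

section Factor

variable [Fintype α]

/-! ## The absorption factor `Φ_K(h_0,…,h_{m−1})` -/

/-- **The absorption factor** `Φ_K(h_0,…,h_{m−1})`, defined by the insertion recursion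
`Φ_K(h_0,…,h_m) = (K − E h_0)·Φ_K(h_1,…,h_m) + Σ_i Φ_K(h_1,…,h_{i+1}·h_0,…,h_m)`, `Φ_K() = 1`; in closed form
`Φ_K(h) = Σ_{σ ∈ S_m} Π_{c ∈ cyc σ} (K − E(Π_{i ∈ c} h_i))`. [this work] -/
def absorbFactor (μ : α → ℝ) (K : ℝ) : (m : ℕ) → (Fin m → α → ℝ) → ℝ
  | 0, _ => 1
  | m + 1, h =>
      (K - ex μ (h 0)) * absorbFactor μ K m (Fin.tail h) +
        ∑ i : Fin m, absorbFactor μ K m (Function.update (Fin.tail h) i (Fin.tail h i * h 0))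

/-- `Φ_K() = 1`. [this work] -/
theorem absorbFactor_zero (μ : α → ℝ) (K : ℝ) (h : Fin 0 → α → ℝ) : absorbFactor μ K 0 h = 1 := rfl

/-- The insertion recursion for `Φ_K`. [this work] -/
theorem absorbFactor_succ (μ : α → ℝ) (K : ℝ) (m : ℕ) (h : Fin (m + 1) → α → ℝ) :
    absorbFactor μ K (m + 1) h =
      (K - ex μ (h 0)) * absorbFactor μ K m (Fin.tail h) +
        ∑ i : Fin m, absorbFactor μ K m (Function.update (Fin.tail h) i (Fin.tail h i * h 0)) := rfl

/-- **`Φ_K(h) ≥ (K − 1)^m`** for `[0,1]`-valued `h` under a nonnegative weight of mass `1` (each fixed-point factor is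
`K − E h_0 ≥ K − 1`, the inserted terms are `≥ 0`). [this work] -/
theorem absorbFactor_ge {μ : α → ℝ} (hμ₀ : ∀ x, 0 ≤ μ x) (hμ₁ : ∑ x, μ x = 1) {K : ℝ} (hK : 1 ≤ K) :
    ∀ (m : ℕ) (h : Fin m → α → ℝ), (∀ i x, 0 ≤ h i x) → (∀ i x, h i x ≤ 1) →
      (K - 1) ^ m ≤ absorbFactor μ K m h
  | 0, h, _, _ => by simp [absorbFactor]
  | m + 1, h, h0, h1 => by
    rw [absorbFactor_succ, pow_succ]
    have hex : ex μ (h 0) ≤ 1 := by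
      calc ex μ (h 0) ≤ ex μ (fun _ => (1 : ℝ)) := ex_mono hμ₀ (h1 0)
        _ = 1 := ex_const hμ₁ 1
    have htail := absorbFactor_ge hμ₀ hμ₁ hK m (Fin.tail h) (fun i x => h0 i.succ x) (fun i x => h1 i.succ x)
    have hKm : 0 ≤ (K - 1) ^ m := pow_nonneg (by linarith) m
    have hsum : 0 ≤ ∑ i : Fin m,
        absorbFactor μ K m (Function.update (Fin.tail h) i (Fin.tail h i * h 0)) := by
      refine sum_nonneg fun i _ => le_trans (pow_nonneg (by linarith) m) (absorbFactor_ge hμ₀ hμ₁ hK m _ ?_ ?_)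
      · intro j x
        rcases eq_or_ne j i with rfl | hji
        · rw [Function.update_self]; exact mul_nonneg (h0 _ x) (h0 0 x)
        · rw [Function.update_of_ne hji]; exact h0 _ x
      · intro j x
        rcases eq_or_ne j i with rfl | hji
        · rw [Function.update_self]
          calc Fin.tail h j x * h 0 x ≤ 1 * 1 :=
                mul_le_mul (h1 _ x) (h1 0 x) (h0 0 x) zero_le_one
            _ = 1 := one_mul 1
        · rw [Function.update_of_ne hji]; exact h1 _ x
    nlinarith [mul_le_mul (show K - 1 ≤ K - ex μ (h 0) by linarith) htail hKm (by linarith)]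

/-- **`Φ_K(h) ≥ 0`** for `[0,1]`-valued `h`, `K ≥ 1`, under a nonnegative weight of mass `1`. [this work] -/
theorem absorbFactor_nonneg {μ : α → ℝ} (hμ₀ : ∀ x, 0 ≤ μ x) (hμ₁ : ∑ x, μ x = 1) {K : ℝ} (hK : 1 ≤ K)
    (m : ℕ) (h : Fin m → α → ℝ) (h0 : ∀ i x, 0 ≤ h i x) (h1 : ∀ i x, h i x ≤ 1) :
    0 ≤ absorbFactor μ K m h :=
  le_trans (pow_nonneg (by linarith) m) (absorbFactor_ge hμ₀ hμ₁ hK m h h0 h1)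

end Factor

/-! ## The joined family `(h_0,…,h_{m−1}, g_0,…,g_k)` -/

section Join

/-- The family `(h_0,…,h_{m−1}, g_0,…,g_k)` on `Fin (k + m + 1)`: absorbers in the first `m` slots, core in the last `k + 1`.
[this work] -/
def joinFam {k m : ℕ} (h : Fin m → α → ℝ) (g : Fin (k + 1) → α → ℝ) : Fin (k + m + 1) → α → ℝ :=
  fun i => if hi : (i : ℕ) < m then h ⟨i, hi⟩ else g ⟨(i : ℕ) - m, by omega⟩

/-- Absorber slots of the joined family. [this work] -/
theorem joinFam_of_lt {k m : ℕ} (h : Fin m → α → ℝ) (g : Fin (k + 1) → α → ℝ) (i : Fin (k + m + 1))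
    (hi : (i : ℕ) < m) : joinFam h g i = h ⟨i, hi⟩ := by
  simp [joinFam, hi]

/-- Core slots of the joined family. [this work] -/
theorem joinFam_of_le {k m : ℕ} (h : Fin m → α → ℝ) (g : Fin (k + 1) → α → ℝ) (i : Fin (k + m + 1))
    (hi : m ≤ (i : ℕ)) : joinFam h g i = g ⟨(i : ℕ) - m, by omega⟩ := by
  simp [joinFam, Nat.not_lt.2 hi]

/-- With no absorbers the joined family is the core. [this work] -/
theorem joinFam_zero {k : ℕ} (h : Fin 0 → α → ℝ) (g : Fin (k + 1) → α → ℝ) : joinFam h g = g := by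
  funext i
  rw [joinFam_of_le h g i (Nat.zero_le _)]
  congr 1

/-- Slot `0` of the joined family is the first absorber. [this work] -/
theorem joinFam_head {k m : ℕ} (h : Fin (m + 1) → α → ℝ) (g : Fin (k + 1) → α → ℝ) :
    joinFam (k := k) (m := m + 1) h g 0 = h 0 :=
  joinFam_of_lt h g 0 (Nat.succ_pos m)

/-- The tail of the joined family is the joined family of the tail. [this work] -/
theorem tail_joinFam {k m : ℕ} (h : Fin (m + 1) → α → ℝ) (g : Fin (k + 1) → α → ℝ) :
    Fin.tail (joinFam (k := k) (m := m + 1) h g) = joinFam (Fin.tail h) g := by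
  funext i
  show joinFam h g i.succ = joinFam (Fin.tail h) g i
  by_cases hi : (i : ℕ) < m
  · rw [joinFam_of_lt _ _ _ hi, joinFam_of_lt h g i.succ (by rw [Fin.val_succ]; omega)]
    rfl
  · rw [joinFam_of_le _ _ _ (Nat.not_lt.1 hi), joinFam_of_le h g i.succ (by rw [Fin.val_succ]; omega)]
    congr 1
    ext
    simp only [Fin.val_succ]
    omega

/-- Updating an absorber slot of the joined family. [this work] -/
theorem update_joinFam_of_lt {k m : ℕ} (h : Fin m → α → ℝ) (g : Fin (k + 1) → α → ℝ) (i : Fin (k + m + 1))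
    (hi : (i : ℕ) < m) (u : α → ℝ) :
    Function.update (joinFam h g) i u = joinFam (Function.update h ⟨i, hi⟩ u) g := by
  funext x
  by_cases hx : x = i
  · subst hx
    rw [Function.update_self, joinFam_of_lt _ _ _ hi, Function.update_self]
  · rw [Function.update_of_ne hx]
    by_cases hxm : (x : ℕ) < m
    · rw [joinFam_of_lt _ _ _ hxm, joinFam_of_lt _ _ _ hxm, Function.update_of_ne]
      intro hc
      exact hx (Fin.ext (by simpa using congrArg Fin.val hc))
    · rw [joinFam_of_le _ _ _ (Nat.not_lt.1 hxm), joinFam_of_le _ _ _ (Nat.not_lt.1 hxm)]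

end Join

/-! ## The factorisation -/

section Main

variable [Fintype α]

/-- **THE JOIN-ABSORPTION FACTORISATION** (every order, every weight): if `g_j · h_i = g_j` for all `i, j`, then
`E_{k+1+m}(h_0,…,h_{m−1},g_0,…,g_k) = Φ_{k+1}(h) · E_{k+1}(g)`. [this work; LiebSahi2021, Prop. 3.3 and Lemma 3.2 (the case `m = 1`)] -/
theorem sahiE_joinFam_eq (μ : α → ℝ) (k : ℕ) (g : Fin (k + 1) → α → ℝ) :
    ∀ (m : ℕ) (h : Fin m → α → ℝ), (∀ i j, g j * h i = g j) →
      sahiE μ (k + m + 1) (joinFam h g) = absorbFactor μ (k + 1) m h * sahiE μ (k + 1) g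
  | 0, h, _ => by
    rw [joinFam_zero, absorbFactor_zero, one_mul]
  | m + 1, h, hgh => by
    have IH := sahiE_joinFam_eq μ k g m
    show sahiE μ (k + m + 2) (joinFam (k := k) (m := m + 1) h g) = _
    rw [sahiE_succ_succ, tail_joinFam, joinFam_head, absorbFactor_succ]
    -- absorption for the tail and for updated absorber families
    have htail : ∀ i j, g j * Fin.tail h i = g j := fun i j => hgh i.succ j
    have hupd : ∀ (a : Fin m) (i : Fin m) (j : Fin (k + 1)),
        g j * Function.update (Fin.tail h) a (Fin.tail h a * h 0) i = g j := by
      intro a i j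
      rcases eq_or_ne i a with rfl | hia
      · rw [Function.update_self, ← mul_assoc, htail, hgh]
      · rw [Function.update_of_ne hia, htail]
    -- the summand at an absorber slot / at a core slot
    have hA : ∀ (i : Fin (k + m + 1)) (hi : (i : ℕ) < m),
        sahiE μ (k + m + 1) (Function.update (joinFam (Fin.tail h) g) i (joinFam (Fin.tail h) g i * h 0)) =
          absorbFactor μ (k + 1) m (Function.update (Fin.tail h) ⟨i, hi⟩ (Fin.tail h ⟨i, hi⟩ * h 0)) *
            sahiE μ (k + 1) g := by
      intro i hi
      rw [joinFam_of_lt _ _ _ hi, update_joinFam_of_lt _ _ _ hi, IH _ (hupd ⟨i, hi⟩)]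
    have hC : ∀ (i : Fin (k + m + 1)), m ≤ (i : ℕ) →
        sahiE μ (k + m + 1) (Function.update (joinFam (Fin.tail h) g) i (joinFam (Fin.tail h) g i * h 0)) =
          absorbFactor μ (k + 1) m (Fin.tail h) * sahiE μ (k + 1) g := by
      intro i hi
      rw [joinFam_of_le _ _ _ hi, hgh, ← joinFam_of_le (Fin.tail h) g i hi, Function.update_eq_self, IH _ htail]
    -- split the slot sum into absorber slots and core slots
    have e : k + m + 1 = m + (k + 1) := by omega
    have hsplit : (∑ i : Fin (k + m + 1),
        sahiE μ (k + m + 1) (Function.update (joinFam (Fin.tail h) g) i (joinFam (Fin.tail h) g i * h 0))) =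
        (∑ a : Fin m, absorbFactor μ (k + 1) m (Function.update (Fin.tail h) a (Fin.tail h a * h 0)) *
            sahiE μ (k + 1) g) +
          ∑ _b : Fin (k + 1), absorbFactor μ (k + 1) m (Fin.tail h) * sahiE μ (k + 1) g := by
      rw [← (finCongr e).symm.sum_comp, Fin.sum_univ_add]
      congr 1
      · refine sum_congr rfl fun a _ => ?_
        have ha : (((finCongr e).symm (Fin.castAdd (k + 1) a) : Fin (k + m + 1)) : ℕ) < m := by simp
        have ha' : (⟨(((finCongr e).symm (Fin.castAdd (k + 1) a) : Fin (k + m + 1)) : ℕ), ha⟩ : Fin m) = a :=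
          Fin.ext (by simp)
        rw [hA _ ha, ha']
      · refine sum_congr rfl fun b _ => ?_
        have hb : m ≤ (((finCongr e).symm (Fin.natAdd m b) : Fin (k + m + 1)) : ℕ) := by simp
        rw [hC _ hb]
    rw [hsplit, IH _ htail, sum_const, card_univ, Fintype.card_fin, nsmul_eq_mul, add_mul, sum_mul]
    push_cast
    ring

/-! ## Positivity consequences -/

/-- **HEREDITY**: under a nonnegative weight of mass `1`, `[0,1]`-valued absorbers and a core with `E_{k+1}(g) ≥ 0` give
`E_{k+1+m}(h, g) ≥ 0`. [this work] -/
theorem sahiE_joinFam_nonneg {μ : α → ℝ} (hμ₀ : ∀ x, 0 ≤ μ x) (hμ₁ : ∑ x, μ x = 1) {k m : ℕ}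
    (h : Fin m → α → ℝ) (g : Fin (k + 1) → α → ℝ) (hgh : ∀ i j, g j * h i = g j)
    (h0 : ∀ i x, 0 ≤ h i x) (h1 : ∀ i x, h i x ≤ 1) (hg : 0 ≤ sahiE μ (k + 1) g) :
    0 ≤ sahiE μ (k + m + 1) (joinFam h g) := by
  rw [sahiE_joinFam_eq μ k g m h hgh]
  have hK : (1 : ℝ) ≤ (k + 1 : ℕ) := by exact_mod_cast Nat.succ_le_succ (Nat.zero_le k)
  exact mul_nonneg (by exact_mod_cast absorbFactor_nonneg hμ₀ hμ₁ (K := ((k + 1 : ℕ) : ℝ)) (by exact_mod_cast hK) m h h0 h1)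
    hg


/-- `SahiPositive μ (k+1)` form of heredity: on a finite preorder carrying a probability weight that is Sahi-positive at order
`k + 1`, a monotone nonnegative core of `k + 1` functions together with ANY number of `[0,1]`-valued functions equal to `1` on the
core's supports (no monotonicity asked of them) has `E ≥ 0`. [this work] -/
theorem sahiE_joinFam_nonneg_of_sahiPositive [Preorder α] {μ : α → ℝ} (hμ₀ : ∀ x, 0 ≤ μ x) (hμ₁ : ∑ x, μ x = 1)
    {k m : ℕ} (hSP : SahiPositive μ (k + 1)) (h : Fin m → α → ℝ) (g : Fin (k + 1) → α → ℝ)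
    (hgh : ∀ i j, g j * h i = g j) (h0 : ∀ i x, 0 ≤ h i x) (h1 : ∀ i x, h i x ≤ 1)
    (hg0 : ∀ j x, 0 ≤ g j x) (hgm : ∀ j, Monotone (g j)) :
    0 ≤ sahiE μ (k + m + 1) (joinFam h g) :=
  sahiE_joinFam_nonneg hμ₀ hμ₁ h g hgh h0 h1 (hSP g hg0 hgm)

/-! ## Re-indexed forms: bottom element (`k = 0`) and two-function core (`k = 1`) in `Fin.snoc` order -/

/-- Transport of `E_n` along an equality of lengths (bookkeeping). [folklore] -/
theorem sahiE_comp_cast (μ : α → ℝ) {n n' : ℕ} (e : n' = n) (F : Fin n → α → ℝ) :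
    sahiE μ n' (fun i => F (Fin.cast e i)) = sahiE μ n F := by
  subst e
  rfl

omit [Fintype α] in
/-- A one-element vector takes its only value at every index of `Fin (0 + 1)` (bookkeeping). [folklore] -/
theorem vecCons_fin_zero_add_one (f : α → ℝ) (j : Fin (0 + 1)) : (![f] : Fin 1 → α → ℝ) j = f := by
  have hj : j = 0 := Fin.ext (by have := j.isLt; omega)
  subst hj
  rfl

omit [Fintype α] in
/-- `(h_0,…,h_{m−1}, f)` is the joined family with the one-element core `![f]`. [this work] -/
theorem snoc_eq_joinFam {m : ℕ} (h : Fin m → α → ℝ) (f : α → ℝ) :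
    (Fin.snoc h f : Fin (m + 1) → α → ℝ) =
      fun i => joinFam (k := 0) h ![f] (Fin.cast (by omega) i) := by
  funext i
  refine Fin.lastCases ?_ (fun j => ?_) i
  · rw [Fin.snoc_last, joinFam_of_le _ _ _ (by simp), vecCons_fin_zero_add_one]
  · rw [Fin.snoc_castSucc, joinFam_of_lt _ _ _ (by simp)]
    rfl

/-- **Bottom-element factorisation** (`k = 0`): if `f · h_i = f` for all `i` then
`E_{m+1}(h_0,…,h_{m−1}, f) = Φ_1(h) · E(f)`. [this work; LiebSahi2021, Lemma 3.2 (chains)] -/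
theorem sahiE_snoc_eq_of_absorbing (μ : α → ℝ) {m : ℕ} (h : Fin m → α → ℝ) (f : α → ℝ)
    (hfh : ∀ i, f * h i = f) :
    sahiE μ (m + 1) (Fin.snoc h f : Fin (m + 1) → α → ℝ) = absorbFactor μ 1 m h * ex μ f := by
  rw [snoc_eq_joinFam, sahiE_comp_cast, sahiE_joinFam_eq μ 0 ![f] m h (fun i j => ?_), sahiE_one]
  · norm_num
  · rw [vecCons_fin_zero_add_one]
    exact hfh i

/-- **BOTTOM-ELEMENT THEOREM** (every order, every probability weight, no monotonicity): if `f ≥ 0` and every `h_i` is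
`[0,1]`-valued with `h_i = 1` wherever `f ≠ 0` (`f · h_i = f`), then `E_{m+1}(h_0,…,h_{m−1}, f) ≥ 0`. [this work] -/
theorem sahiE_snoc_nonneg_of_bottom {μ : α → ℝ} (hμ₀ : ∀ x, 0 ≤ μ x) (hμ₁ : ∑ x, μ x = 1) {m : ℕ}
    (h : Fin m → α → ℝ) (f : α → ℝ) (hfh : ∀ i, f * h i = f) (hf : ∀ x, 0 ≤ f x)
    (h0 : ∀ i x, 0 ≤ h i x) (h1 : ∀ i x, h i x ≤ 1) :
    0 ≤ sahiE μ (m + 1) (Fin.snoc h f : Fin (m + 1) → α → ℝ) := by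
  rw [sahiE_snoc_eq_of_absorbing μ h f hfh]
  exact mul_nonneg (absorbFactor_nonneg hμ₀ hμ₁ le_rfl m h h0 h1) (ex_nonneg hμ₀ hf)

/-- **Events with a least member**: for sets `G ⊆ H_i` (all `i`) and any probability weight,
`E_{m+1}(1_{H_0},…,1_{H_{m−1}}, 1_G) ≥ 0` — only a common BOTTOM is needed, the `H_i` are arbitrary
(the nested case is `Literature.…Sahi2008.sahiE_indicator_chain_nonneg`). [this work] -/
theorem sahiE_indicator_nonneg_of_subset_all {μ : α → ℝ} (hμ₀ : ∀ x, 0 ≤ μ x) (hμ₁ : ∑ x, μ x = 1) {m : ℕ}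
    (H : Fin m → Set α) (G : Set α) (hGH : ∀ i, G ⊆ H i) :
    0 ≤ sahiE μ (m + 1)
      (Fin.snoc (fun i => (H i).indicator (1 : α → ℝ)) (G.indicator 1) : Fin (m + 1) → α → ℝ) := by
  classical
  refine sahiE_snoc_nonneg_of_bottom hμ₀ hμ₁ _ _ (fun i => ?_) (fun x => Set.indicator_nonneg (fun _ _ => zero_le_one) x)
    (fun i x => Set.indicator_nonneg (fun _ _ => zero_le_one) x)
    (fun i x => Set.indicator_le_self' (fun _ _ => zero_le_one) x)
  rw [← Set.inter_indicator_one, Set.inter_eq_left.2 (hGH i)]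

omit [Fintype α] in
/-- `(h_0,…,h_{m−1}, g_0, g_1)` is the joined family with the two-element core `![g_0, g_1]`. [this work] -/
theorem snoc_snoc_eq_joinFam {m : ℕ} (h : Fin m → α → ℝ) (g₀ g₁ : α → ℝ) :
    (Fin.snoc (Fin.snoc h g₀ : Fin (m + 1) → α → ℝ) g₁ : Fin (m + 2) → α → ℝ) =
      fun i => joinFam (k := 1) h ![g₀, g₁] (Fin.cast (by omega) i) := by
  funext i
  refine Fin.lastCases ?_ (fun j => ?_) i
  · rw [Fin.snoc_last, joinFam_of_le _ _ _ (by simp)]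
    have : (⟨((Fin.cast (show m + 2 = 1 + m + 1 by omega) (Fin.last (m + 1)) : Fin (1 + m + 1)) : ℕ) - m,
        by simp⟩ : Fin 2) = 1 := Fin.ext (by simp)
    rw [this]
    rfl
  · rw [Fin.snoc_castSucc]
    refine Fin.lastCases ?_ (fun j' => ?_) j
    · rw [Fin.snoc_last, joinFam_of_le _ _ _ (by simp)]
      have : (⟨((Fin.cast (show m + 2 = 1 + m + 1 by omega) (Fin.last m).castSucc : Fin (1 + m + 1)) : ℕ) - m,
          by simp⟩ : Fin 2) = 0 := Fin.ext (by simp)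
      rw [this]
      rfl
    · rw [Fin.snoc_castSucc, joinFam_of_lt _ _ _ (by simp)]
      rfl

/-- **Two-function core** (`k = 1`): if `g_0 · h_i = g_0` and `g_1 · h_i = g_1` for all `i` then
`E_{m+2}(h_0,…,h_{m−1}, g_0, g_1) = Φ_2(h) · (E(g_0 g_1) − E(g_0)E(g_1))` — `E_{m+2}` is the covariance of the core times
the absorption factor. [this work] -/
theorem sahiE_snoc_snoc_eq_of_absorbing (μ : α → ℝ) {m : ℕ} (h : Fin m → α → ℝ) (g₀ g₁ : α → ℝ)
    (hg₀ : ∀ i, g₀ * h i = g₀) (hg₁ : ∀ i, g₁ * h i = g₁) :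
    sahiE μ (m + 2) (Fin.snoc (Fin.snoc h g₀ : Fin (m + 1) → α → ℝ) g₁ : Fin (m + 2) → α → ℝ) =
      absorbFactor μ 2 m h * (ex μ (g₀ * g₁) - ex μ g₀ * ex μ g₁) := by
  rw [snoc_snoc_eq_joinFam, sahiE_comp_cast, sahiE_joinFam_eq μ 1 ![g₀, g₁] m h (fun i j => ?_), sahiE_two]
  · norm_num
  · fin_cases j
    · exact hg₀ i
    · exact hg₁ i

/-- **VANISHING**: with an uncorrelated two-function core, `E_{m+2}(h, g_0, g_1) = 0` for every weight — e.g.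
`E_n(X∨Y∨⋯, …, X, Y) = 0` for independent events `X, Y` absorbed by all other slots. [this work] -/
theorem sahiE_snoc_snoc_eq_zero_of_cov_eq_zero (μ : α → ℝ) {m : ℕ} (h : Fin m → α → ℝ) (g₀ g₁ : α → ℝ)
    (hg₀ : ∀ i, g₀ * h i = g₀) (hg₁ : ∀ i, g₁ * h i = g₁) (hcov : ex μ (g₀ * g₁) = ex μ g₀ * ex μ g₁) :
    sahiE μ (m + 2) (Fin.snoc (Fin.snoc h g₀ : Fin (m + 1) → α → ℝ) g₁ : Fin (m + 2) → α → ℝ) = 0 := by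
  rw [sahiE_snoc_snoc_eq_of_absorbing μ h g₀ g₁ hg₀ hg₁, hcov, sub_self, mul_zero]

/-- **SIGN THEOREM**: under a probability weight, with `[0,1]`-valued absorbers, `E_{m+2}(h, g_0, g_1) ≥ 0` IFF the
covariance of the core is `≥ 0` (the factor `Φ_2(h) ≥ 1` is positive); in particular Harris/FKG positivity of `Cov(g_0,g_1)`
gives Sahi positivity of the whole family at every order. [this work] -/
theorem sahiE_snoc_snoc_nonneg_iff {μ : α → ℝ} (hμ₀ : ∀ x, 0 ≤ μ x) (hμ₁ : ∑ x, μ x = 1) {m : ℕ}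
    (h : Fin m → α → ℝ) (g₀ g₁ : α → ℝ) (hg₀ : ∀ i, g₀ * h i = g₀) (hg₁ : ∀ i, g₁ * h i = g₁)
    (h0 : ∀ i x, 0 ≤ h i x) (h1 : ∀ i x, h i x ≤ 1) :
    0 ≤ sahiE μ (m + 2) (Fin.snoc (Fin.snoc h g₀ : Fin (m + 1) → α → ℝ) g₁ : Fin (m + 2) → α → ℝ) ↔
      0 ≤ ex μ (g₀ * g₁) - ex μ g₀ * ex μ g₁ := by
  rw [sahiE_snoc_snoc_eq_of_absorbing μ h g₀ g₁ hg₀ hg₁]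
  have hΦ : 0 < absorbFactor μ 2 m h :=
    lt_of_lt_of_le (by norm_num) (absorbFactor_ge hμ₀ hμ₁ (K := 2) (by norm_num) m h h0 h1)
  exact mul_nonneg_iff_of_pos_left hΦ

end Main

end SahiJoinAbsorption

end Summit.CriticalPhenomena.PercolationContinuityZ3.Theorems
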